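import Summits.AtomisticToContinuum.Crystallization.Theorems.PalmUnimodularRigidityShellsToBarlowChartTransportOpsDefs

/-!
# Line `develop-the-model-growth-descent` (crux `ShellsToBarlowChart`, stmt-AtomisticToContinuum-9227): pattern facts, part 3

Decidable facts about the two integer kissing patterns `fcc3Int`, `hcpInt` (labels at squared
norm `18`) used by the frame transports of `stub_transportSystem`: hexagons, even/odd caps,
their filters, apexes, distance tables, lower caps and the letters read on them.  Every fact was
first verified by brute force (work/sim/facts.py of the lead's folder) and is proved here by
`decide` (split into small files so that each elaborates quickly).  All `[folklore]`
(finite checks on the cuboctahedron / anticuboctahedron, HalesDSP2012 §1.3).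
-/

namespace Summit.AtomisticToContinuum.Crystallization.Theorems.PalmUnimodularRigidityShellsToBarlowChart

open Literature.Geometry.DiscreteGeometry

/-- FCC: the difference of two touching labels is a label. [folklore] -/
theorem sub_mem_of_touching_fcc3Int : ∀ a ∈ fcc3Int, ∀ b ∈ fcc3Int, sqNormInt (a - b) = 18 → a - b ∈ fcc3Int := by
  decide

/-- The difference of two touching labels on one side (both symmetric or both non-symmetric) is a label. [folklore] -/
theorem sub_mem_of_onesided : ∀ P : Finset (Fin 3 → ℤ), (P = fcc3Int ∨ P = hcpInt) →
    ∀ ξ ∈ P, ∀ η ∈ P, sqNormInt (ξ - η) = 18 → ((-ξ ∈ P ∧ -η ∈ P) ∨ (-ξ ∉ P ∧ -η ∉ P)) → η - ξ ∈ P := by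
  rintro P (rfl | rfl) <;> decide

/-- I-step, even frame: the cap at the new site from the transported apex image `μ` (`μ ~ w`, `μ ~ v`). [folklore] -/
theorem apex_I_even : ∀ P : Finset (Fin 3 → ℤ), (P = fcc3Int ∨ P = hcpInt) →
    ∀ w ∈ P, ∀ v ∈ P, ∀ μ ∈ P, -w ∈ P → -v ∈ P → sqNormInt (w - v) = 18 → sqNormInt (w - μ) = 18 → sqNormInt (v - μ) = 18 → IsFrame P (-w) (v - w) ({μ - w, μ, μ - v} : Finset (Fin 3 → ℤ)) ∧ frameParity (-w) (v - w) ({μ - w, μ, μ - v} : Finset (Fin 3 → ℤ)) = 1 ∧ capWithAny P (-w) (v - w) {μ} = ({μ - w, μ, μ - v} : Finset (Fin 3 → ℤ)) ∧ (μ - w) ∉ hexLabels (-w) (v - w) ∧ μ - w ∈ P ∧ μ - v ∈ P := by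
  rintro P (rfl | rfl) <;> decide

/-- I-step, odd frame: the cap at the new site from the transported image `μ` of the `U`-element touching `t₁` (`μ ~ w`, `μ ~ w − v`, `D(v, μ) = 36`). [folklore] -/
theorem apex_I_odd : ∀ P : Finset (Fin 3 → ℤ), (P = fcc3Int ∨ P = hcpInt) →
    ∀ w ∈ P, ∀ v ∈ P, ∀ μ ∈ P, -w ∈ P → -v ∈ P → sqNormInt (w - v) = 18 → sqNormInt (w - μ) = 18 → sqNormInt (w - v - μ) = 18 → sqNormInt (v - μ) = 36 → IsFrame P (-w) (v - w) ({μ, μ - w, μ + v - w} : Finset (Fin 3 → ℤ)) ∧ frameParity (-w) (v - w) ({μ, μ - w, μ + v - w} : Finset (Fin 3 → ℤ)) = -1 ∧ capWithAny P (-w) (v - w) {μ} = ({μ, μ - w, μ + v - w} : Finset (Fin 3 → ℤ)) := by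
  rintro P (rfl | rfl) <;> decide

/-- J-step, even frame: the cap at the new site (`μ ~ w`, `μ ~ v`, frame `(v − w, −w)`). [folklore] -/
theorem apex_J_even : ∀ P : Finset (Fin 3 → ℤ), (P = fcc3Int ∨ P = hcpInt) →
    ∀ w ∈ P, ∀ v ∈ P, ∀ μ ∈ P, -w ∈ P → -v ∈ P → sqNormInt (w - v) = 18 → sqNormInt (w - μ) = 18 → sqNormInt (v - μ) = 18 → IsFrame P (v - w) (-w) ({μ - w, μ - v, μ} : Finset (Fin 3 → ℤ)) ∧ frameParity (v - w) (-w) ({μ - w, μ - v, μ} : Finset (Fin 3 → ℤ)) = 1 ∧ capWithAny P (v - w) (-w) {μ} = ({μ - w, μ - v, μ} : Finset (Fin 3 → ℤ)) := by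
  rintro P (rfl | rfl) <;> decide

/-- J-step, odd frame: the cap at the new site from the image `μ` of the `U`-element touching `t₂` (`μ ~ w`, `μ ~ w − v`, `D(v, μ) = 36`, frame `(v − w, −w)`). [folklore] -/
theorem apex_J_odd : ∀ P : Finset (Fin 3 → ℤ), (P = fcc3Int ∨ P = hcpInt) →
    ∀ w ∈ P, ∀ v ∈ P, ∀ μ ∈ P, -w ∈ P → -v ∈ P → sqNormInt (w - v) = 18 → sqNormInt (w - μ) = 18 → sqNormInt (w - v - μ) = 18 → sqNormInt (v - μ) = 36 → IsFrame P (v - w) (-w) ({μ, μ + v - w, μ - w} : Finset (Fin 3 → ℤ)) ∧ frameParity (v - w) (-w) ({μ, μ + v - w, μ - w} : Finset (Fin 3 → ℤ)) = -1 ∧ capWithAny P (v - w) (-w) {μ} = ({μ, μ + v - w, μ - w} : Finset (Fin 3 → ℤ)) := by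
  rintro P (rfl | rfl) <;> decide

/-- I⁻¹-step, even frame: cap from `μ` = image of `c − t₁` (`μ ~ w`, `μ ~ v`, frame `(w, v)`). [folklore] -/
theorem apex_Iinv_even : ∀ P : Finset (Fin 3 → ℤ), (P = fcc3Int ∨ P = hcpInt) →
    ∀ w ∈ P, ∀ v ∈ P, ∀ μ ∈ P, -w ∈ P → -v ∈ P → sqNormInt (w - v) = 18 → sqNormInt (w - μ) = 18 → sqNormInt (v - μ) = 18 → IsFrame P w v ({μ, μ - w, μ - v} : Finset (Fin 3 → ℤ)) ∧ frameParity w v ({μ, μ - w, μ - v} : Finset (Fin 3 → ℤ)) = 1 ∧ capWithAny P w v {μ} = ({μ, μ - w, μ - v} : Finset (Fin 3 → ℤ)) := by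
  rintro P (rfl | rfl) <;> decide

/-- I⁻¹-step, odd frame: cap from `μ` = image of `c` (`μ ~ w`, `μ ~ w − v`, `D(v, μ) = 36`, frame `(w, v)`). [folklore] -/
theorem apex_Iinv_odd : ∀ P : Finset (Fin 3 → ℤ), (P = fcc3Int ∨ P = hcpInt) →
    ∀ w ∈ P, ∀ v ∈ P, ∀ μ ∈ P, -w ∈ P → -v ∈ P → sqNormInt (w - v) = 18 → sqNormInt (w - μ) = 18 → sqNormInt (w - v - μ) = 18 → sqNormInt (v - μ) = 36 → IsFrame P w v ({μ - w, μ, μ - w + v} : Finset (Fin 3 → ℤ)) ∧ frameParity w v ({μ - w, μ, μ - w + v} : Finset (Fin 3 → ℤ)) = -1 ∧ capWithAny P w v {μ} = ({μ - w, μ, μ - w + v} : Finset (Fin 3 → ℤ)) := by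
  rintro P (rfl | rfl) <;> decide

/-- J⁻¹-step, even frame: cap from `μ` = image of `c − t₂` (`μ ~ w`, `μ ~ v`, frame `(v, w)`). [folklore] -/
theorem apex_Jinv_even : ∀ P : Finset (Fin 3 → ℤ), (P = fcc3Int ∨ P = hcpInt) →
    ∀ w ∈ P, ∀ v ∈ P, ∀ μ ∈ P, -w ∈ P → -v ∈ P → sqNormInt (w - v) = 18 → sqNormInt (w - μ) = 18 → sqNormInt (v - μ) = 18 → IsFrame P v w ({μ, μ - v, μ - w} : Finset (Fin 3 → ℤ)) ∧ frameParity v w ({μ, μ - v, μ - w} : Finset (Fin 3 → ℤ)) = 1 ∧ capWithAny P v w {μ} = ({μ, μ - v, μ - w} : Finset (Fin 3 → ℤ)) := by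
  rintro P (rfl | rfl) <;> decide

/-- J⁻¹-step, odd frame: cap from `μ` = image of `c` (`μ ~ w`, `μ ~ w − v`, `D(v, μ) = 36`, frame `(v, w)`). [folklore] -/
theorem apex_Jinv_odd : ∀ P : Finset (Fin 3 → ℤ), (P = fcc3Int ∨ P = hcpInt) →
    ∀ w ∈ P, ∀ v ∈ P, ∀ μ ∈ P, -w ∈ P → -v ∈ P → sqNormInt (w - v) = 18 → sqNormInt (w - μ) = 18 → sqNormInt (w - v - μ) = 18 → sqNormInt (v - μ) = 36 → IsFrame P v w ({μ - w, μ - w + v, μ} : Finset (Fin 3 → ℤ)) ∧ frameParity v w ({μ - w, μ - w + v, μ} : Finset (Fin 3 → ℤ)) = -1 ∧ capWithAny P v w {μ} = ({μ - w, μ - w + v, μ} : Finset (Fin 3 → ℤ)) := by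
  rintro P (rfl | rfl) <;> decide

/-- Two touching off-hexagon labels determine the same cap. [folklore] -/
theorem capWithAny_congr : ∀ P : Finset (Fin 3 → ℤ), (P = fcc3Int ∨ P = hcpInt) →
    ∀ a ∈ P, ∀ b ∈ P, ∀ m ∈ P, ∀ n ∈ P, sqNormInt (a - b) = 18 → hexLabels a b ⊆ P → m ∉ hexLabels a b → n ∉ hexLabels a b → sqNormInt (m - n) = 18 → capWithAny P a b {m} = capWithAny P a b {n} := by
  rintro P (rfl | rfl) <;> decide

end Summit.AtomisticToContinuum.Crystallization.Theorems.PalmUnimodularRigidityShellsToBarlowChart
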